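import Summits.Ventures.PercRepro.GenQFlatLatticeC

/-!
# PercRepro — the flat-lattice counting rows, part E: the non-spanning complements (night-4, gen 11)

A `k`-subset `A ⊆ G` whose complement does not span lies above `G ∖ F` for the flat `F = cl(G ∖ A)` — a flat of rank
`ρ < q` with a spanning trace — and the `k`-subsets above `G ∖ F` number `≤ C(|F ∩ G|, k + |F ∩ G| − n)`.  So

`#{A : |A| = k, G ∖ A non-spanning} ≤ Σ_{ρ < q} Σ_s C(s, k + s − n)·h^{(ρ)}_s`   (`card_nonspanning_compl_le`),

and with part C's `gA`: `#{k-subsets of rank ≤ t − 1} ≤ gA_k + Σ_{ρ < q} Σ_s C(s, k + s − n)·h^{(ρ)}_s` (`gc_row`) —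
the row (G-C) of the two-level profile LP (sheet §65 (b)).  Imports `GenQFlatLatticeC`.
-/
namespace PercRepro.Night4

open Finset ThmH SixFour GenQ PerFlat Star

variable {α : Type*} [DecidableEq α] {M : Matroid α} [M.Finite]

/-- The `k`-subsets of `G` containing `G ∖ F` number at most `C(|F ∩ G|, k + |F ∩ G| − n)`. -/
theorem card_powersetCard_superset_le (G F : Finset α) (k : ℕ) :
    ((G.powersetCard k).filter (fun A : Finset α => G \ F ⊆ A)).card ≤ (F ∩ G).card.choose (k + (F ∩ G).card - G.card) := by
  classical
  rw [← Finset.card_powersetCard]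
  refine Finset.card_le_card_of_injOn (fun A => A ∩ F) ?_ ?_
  · intro A hA
    rw [Finset.mem_coe, Finset.mem_filter, Finset.mem_powersetCard] at hA
    rw [Finset.mem_coe, Finset.mem_powersetCard]
    refine ⟨fun y hy => ?_, ?_⟩
    · rw [Finset.mem_inter] at hy ⊢
      exact ⟨hy.2, hA.1.1 hy.1⟩
    -- `A = (G ∖ F) ∪ (A ∩ F)` disjointly
    have hunion : A = (G \ F) ∪ (A ∩ F) := by
      ext y
      simp only [Finset.mem_union, Finset.mem_sdiff, Finset.mem_inter]
      constructor
      · intro hy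
        by_cases hyF : y ∈ F
        · exact Or.inr ⟨hy, hyF⟩
        · exact Or.inl ⟨hA.1.1 hy, hyF⟩
      · rintro (hy | hy)
        · exact hA.2 (Finset.mem_sdiff.2 hy)
        · exact hy.1
    have hdisj : Disjoint (G \ F) (A ∩ F) := by
      rw [Finset.disjoint_left]
      intro y hy hy'
      exact (Finset.mem_sdiff.1 hy).2 (Finset.mem_inter.1 hy').2
    have hcard : A.card = (G \ F).card + (A ∩ F).card := by
      conv_lhs => rw [hunion]
      rw [Finset.card_union_of_disjoint hdisj]
    have hGF := card_sdiff_eq_card_sub_card_inter G F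
    have hle := Finset.card_le_card (Finset.inter_subset_right (s₁ := F) (s₂ := G))
    rw [hA.1.2] at hcard
    show (A ∩ F).card = k + (F ∩ G).card - G.card
    omega
  · intro A hA A' hA' h
    rw [Finset.mem_coe, Finset.mem_filter] at hA hA'
    have hunion : ∀ B : Finset α, G \ F ⊆ B → B ⊆ G → B = (G \ F) ∪ (B ∩ F) := by
      intro B hB hBG
      ext y
      simp only [Finset.mem_union, Finset.mem_sdiff, Finset.mem_inter]
      constructor
      · intro hy
        by_cases hyF : y ∈ F
        · exact Or.inr ⟨hy, hyF⟩
        · exact Or.inl ⟨hBG hy, hyF⟩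
      · rintro (hy | hy)
        · exact hB (Finset.mem_sdiff.2 hy)
        · exact hy.1
    rw [hunion A hA.2 (Finset.mem_powersetCard.1 hA.1).1, hunion A' hA'.2 (Finset.mem_powersetCard.1 hA'.1).1]
    simp only at h
    rw [h]

/-- The closure of a rank-`ρ` subset of `G` is a rank-`ρ` flat with a spanning trace. -/
theorem clF_mem_flatsTr {G X : Finset α} {ρ : ℕ} (hG : G ⊆ gr M) (hX : X ⊆ G)
    (hr : M.eRk (X : Set α) = (ρ : ℕ∞)) :
    clF M X ∈ flatsTr M G ρ (clF M X ∩ G).card := by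
  have hXE : (X : Set α) ⊆ M.E := by
    rw [← coe_gr M]
    exact Finset.coe_subset.2 (hX.trans hG)
  have hXcl : X ⊆ clF M X ∩ G := by
    intro y hy
    rw [Finset.mem_inter, mem_clF]
    exact ⟨M.subset_closure _ hXE (Finset.mem_coe.2 hy), hX hy⟩
  have hflat : clF M X ∈ flatsQ M ρ := by
    rw [mem_flatsQ, ← Finset.coe_subset, coe_clF, coe_gr]
    exact ⟨M.closure_subset_ground _, M.isFlat_closure _, by rw [M.eRk_closure_eq, hr]⟩
  unfold flatsTr
  rw [Finset.mem_filter]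
  refine ⟨hflat, rfl, le_antisymm ?_ ?_⟩
  · rw [← (mem_flatsQ.1 hflat).2.2]
    exact M.eRk_mono (Finset.coe_subset.2 Finset.inter_subset_left)
  · rw [← hr]
    exact M.eRk_mono (Finset.coe_subset.2 hXcl)

/-- The `k`-subsets with non-spanning complement are at most `Σ_{ρ < q} Σ_s C(s, k + s − n)·h^{(ρ)}_s`. -/
theorem card_nonspanning_compl_le {G : Finset α} {q : ℕ} (hG : G ⊆ gr M)
    (hrG : M.eRk (G : Set α) = (q : ℕ∞)) (k : ℕ) :
    ((G.powersetCard k).filter (fun A : Finset α => G \ A ∉ Rq M G q)).card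
      ≤ ∑ ρ ∈ Finset.range q, ∑ s ∈ Finset.range (G.card + 1), s.choose (k + s - G.card) * hypTr M G ρ s := by
  classical
  -- the cover by the flats `cl(G ∖ A)`
  have hcover : (G.powersetCard k).filter (fun A : Finset α => G \ A ∉ Rq M G q)
      ⊆ (Finset.range q).biUnion (fun ρ => (Finset.range (G.card + 1)).biUnion (fun s =>
          (flatsTr M G ρ s).biUnion (fun F => (G.powersetCard k).filter (fun A : Finset α => G \ F ⊆ A)))) := by
    intro A hA
    rw [Finset.mem_filter, Finset.mem_powersetCard] at hA
    obtain ⟨⟨hAG, hAk⟩, hns⟩ := hA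
    obtain ⟨ρ, hρ⟩ := exists_eRk_eq_nat (M := M) (G \ A)
    have hρq : ρ < q := by
      have hle : M.eRk ((G \ A : Finset α) : Set α) ≤ (q : ℕ∞) := by
        rw [← hrG]
        exact M.eRk_mono (Finset.coe_subset.2 Finset.sdiff_subset)
      rw [hρ] at hle
      have h1 : ρ ≤ q := by exact_mod_cast hle
      rcases Nat.lt_or_ge ρ q with h | h
      · exact h
      · exfalso
        have hρq' : ρ = q := le_antisymm h1 h
        apply hns
        rw [mem_Rq]
        exact ⟨Finset.sdiff_subset, by rw [hρ, hρq']⟩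
    have hF := clF_mem_flatsTr hG (Finset.sdiff_subset (s := G) (t := A)) hρ
    simp only [Finset.mem_biUnion, Finset.mem_range]
    refine ⟨ρ, hρq, (clF M (G \ A) ∩ G).card,
      Nat.lt_succ_of_le (Finset.card_le_card Finset.inter_subset_right), clF M (G \ A), hF, ?_⟩
    rw [Finset.mem_filter, Finset.mem_powersetCard]
    refine ⟨⟨hAG, hAk⟩, ?_⟩
    -- `G ∖ cl(G ∖ A) ⊆ A`
    intro y hy
    rw [Finset.mem_sdiff] at hy
    by_contra hyA
    apply hy.2
    rw [mem_clF]
    have hyE : y ∈ M.E := by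
      rw [← coe_gr M, Finset.mem_coe]
      exact hG hy.1
    refine M.subset_closure _ ?_ ?_
    · rw [← coe_gr M]
      exact Finset.coe_subset.2 (Finset.sdiff_subset.trans hG)
    · rw [Finset.mem_coe, Finset.mem_sdiff]
      exact ⟨hy.1, hyA⟩
  refine (Finset.card_le_card hcover).trans ?_
  refine Finset.card_biUnion_le.trans (Finset.sum_le_sum (fun ρ _ => ?_))
  refine Finset.card_biUnion_le.trans (Finset.sum_le_sum (fun s _ => ?_))
  refine Finset.card_biUnion_le.trans ?_
  unfold hypTr
  rw [Finset.card_eq_sum_ones (flatsTr M G ρ s), Finset.mul_sum, mul_one]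
  refine Finset.sum_le_sum (fun F hF => ?_)
  have hF' : F ∈ (flatsQ M ρ).filter
      (fun H : Finset α => (H ∩ G).card = s ∧ M.eRk ((H ∩ G : Finset α) : Set α) = (ρ : ℕ∞)) := hF
  have hs : (F ∩ G).card = s := (Finset.mem_filter.1 hF').2.1
  have h := card_powersetCard_superset_le G F k
  rw [hs] at h
  exact h

/-- **(G-C)**: `#{k-subsets of rank ≤ t − 1} ≤ gA_k + Σ_{ρ < q} Σ_s C(s, k + s − n)·h^{(ρ)}_s`. -/
theorem gc_row {G : Finset α} {q : ℕ} (hG : G ⊆ gr M) (hrG : M.eRk (G : Set α) = (q : ℕ∞)) (t k : ℕ) :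
    ((G.powersetCard k).filter (fun A : Finset α => M.eRk (A : Set α) + 1 ≤ (t : ℕ∞))).card
      ≤ gA M G q t k + ∑ ρ ∈ Finset.range q, ∑ s ∈ Finset.range (G.card + 1),
          s.choose (k + s - G.card) * hypTr M G ρ s := by
  classical
  refine le_trans ?_ (Nat.add_le_add_left (card_nonspanning_compl_le hG hrG k) _)
  unfold gA
  rw [← Finset.card_filter_add_card_filter_not (s := (G.powersetCard k).filter
      (fun A : Finset α => M.eRk (A : Set α) + 1 ≤ (t : ℕ∞))) (p := fun A : Finset α => G \ A ∈ Rq M G q)]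
  refine Nat.add_le_add ?_ ?_
  · refine le_of_eq ?_
    congr 1
    ext A
    simp only [Finset.mem_filter]
    tauto
  · refine Finset.card_le_card (fun A hA => ?_)
    rw [Finset.mem_filter, Finset.mem_filter] at hA
    rw [Finset.mem_filter]
    exact ⟨hA.1.1, hA.2⟩

end PercRepro.Night4
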